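import Summits.BirchSwinnertonDyer.Rank1Residual.X11b.TransvectionAbsIrreducible
import Summits.BirchSwinnertonDyer.Rank1Residual.X11b.RouteLoci
import Literature.NumberTheory.EllipticCurves.BSDSelmerPConverseRamifiedProofs
import Literature.NumberTheory.EllipticCurves.Rank1Residual.Predicates
import Literature.NumberTheory.Automorphic.CDTTheorem722SerreProofs
import Literature.NumberTheory.Automorphic.BCDTTheoremB
import Literature.NumberTheory.Automorphic.LanglandsTetrahedral
import HarnessLib

/-!
# `Irr ∧ Ram` ⟹ `E[p]|_{G_K}` absolutely irreducible for every quadratic `K` (the bridge from the cell's predicates to the transvection lemma)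

HONEST FRAMING (cell `b2b-bsdres`, run/shared/lean/b2b/bsd-rank1-residual/, verbatim in every
file): the goal of the cell is to DELETE the COMBINATION-SHAPED residual classes of the
Birch–Swinnerton-Dyer formula for ALL analytic-rank `≤ 1` elliptic curves over `ℚ` — "full BSD
formula for every rank `≤ 1` curve in class `C`" assembled STRICTLY from published theorems — so
that the rank-`≤ 1` remainder becomes exactly the CONSTRUCTION-SHAPED classes, which are TYPED
(missing-input `Prop`s), NOT attempted. This is not "finishing BSD". Sub-cell
`b2b-bsdres-multr1-p1` (X11b, route R1); no claim beyond the stated class; X11b stays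
CONSTRUCTION-SHAPED; nothing here changes a label; no named fact (theorems only; no `sorry`).

## What this file kernel-checks, and why

`TransvectionAbsIrreducible.lean` (gen 5) proved the GROUP THEORY: a framed `ρ : G → GL₂(A)` over a
field `A` of characteristic `≠ 2`, irreducible and with a transvection `ρ(g₀)` in its image, is
absolutely irreducible on every subgroup of index two — with the DICTIONARY "`A = 𝔽_p`,
`ρ = ρ̄_{E,p}`, `g₀` a generator of tame inertia at a multiplicative prime `q` with `p ∤ v_q(Δ)`"
left as prose. This file turns the dictionary into theorems on the cell's own predicates
(`Literature/NumberTheory/EllipticCurves/Rank1Residual/Predicates.lean`):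

* `Irr W p`  = `E[p]` is an irreducible `Γ_ℚ`-module (`W.HasIrreducibleModPGaloisRep p`);
* `Ram W p`  = there is a prime `ℓ ≠ p` of multiplicative reduction with `p ∤ v_ℓ(Δ_min)`
  (hypothesis (ram)/(mult) of Skinner–Urban 2014, Skinner 2016 Thm. C (ii), Castella 2018 Thm. A
  and the erratum's Thm. A′ — "`E[p]` ramified at `q`").

Results, for `W/ℚ` elliptic and globally minimal, `p` prime, and ANY framed model
`ρ̄ : Γ_ℚ →ₜ* GL₂(𝔽_p)` of `E[p]` (`W.IsTorsionGaloisRep p ρ̄`, file `BCDTModularity`; such models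
exist, `WeierstrassCurve.exists_isTorsionGaloisRep`):

* `exists_unipotent_geomTorsion_of_ram` — **(ram) ⟹ a unipotent Galois element non-trivial on
  `E[p]`**: some `σ ∈ Γ_ℚ` acts on `E[p]` with `(σ − 1)² = 0` and `σ ≠ 1`. This is the tree's
  Tate-curve-free theorem `WeierstrassCurve.exists_unipotent_of_hasMultiplicativeReductionAt`
  (`MultiplicativeUnipotentTorsionProofs`: Kodaira–Néron at the multiplicative place, Hensel,
  Weil pairing) fed by `WeierstrassCurve.exists_inertia_smul_ne_of_hasMultiplicativeReductionAtPrime`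
  (`BSDSelmerPConverseRamifiedProofs`: `p ∤ v_ℓ(Δ_min)` ⟹ inertia at `ℓ` moves a `p`-torsion
  point), specialised to level `p¹`;
* `exists_transvection_of_isTorsionGaloisRep_of_ram` — in any frame, `ρ̄(σ) ≠ 1` and
  `(ρ̄(σ) − 1)² = 0`: **the image of `ρ̄_{E,p}` contains a transvection**;
* `isAbsolutelyIrreducible_of_irr_of_ram` — `Irr ∧ Ram` ⟹ `ρ̄_{E,p}` absolutely irreducible
  (EVERY `p`, including `p = 2`, where the tree's oddness argument
  `BCDT.isAbsolutelyIrreducible_of_hasIrreducibleModPGaloisRep` does not apply);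
* `isAbsolutelyIrreducible_restrictField_of_irr_of_ram` — **`Irr ∧ Ram`, `p ≠ 2` ⟹
  `ρ̄_{E,p}|_{Γ_K}` absolutely irreducible for every quadratic extension `K/ℚ`** (restriction
  `FramedGaloisRep.restrictField K`, along `absGaloisRestrict ℚ K : Γ_K →ₜ* Γ_ℚ`, whose image has
  index `[K:ℚ] = 2`, tree `Automorphic.isOpen_range_absGaloisRestrict_and_index`);
* `isAbsIrreducibleOverSqrt_of_irr_of_ram` — the same in the Conrad–Diamond–Taylor / BCDT
  spelling `ModPGaloisRep.IsAbsIrreducibleOverSqrt d ρ̄` ("`ρ̄|_{ℚ(√d)}` absolutely irreducible")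
  for every non-square `d : ℚ`.

WHY (route R1 / p2 bookkeeping, `CongruenceLimitOneSided.lean`, `CastellaErratumThm23Skeleton.lean`):
the one unrefereed atom of the routes on `Locus`, [FW21, Thm. 4.41] bullet 1, and [Cas20] (iv)
(behind the erratum's congruence (c)) ask "`ρ̄|_{G_K}` ABSOLUTELY irreducible" for the auxiliary
imaginary quadratic `K`, whereas the erratum's Thm. 1.1 (i) / Thm. A′ and the cell's class
predicate carry "`E[p]` irreducible" + "ramified at a multiplicative `q`" (footnote 1 of the
erratum: "implies that `ρ̄_{g_m}|_{G_K}` is irreducible, see [Ski20, Lem. 2.8.1]"). After this file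
that wording gap is closed IN THE KERNEL on all of `ChainLocus ⊆ {Irr ∧ Ram}` (`RouteLoci.lean`:
`ChainLocus.ram`), `p ≥ 5`: no hypothesis on the image of Galois beyond the class predicate is
consumed by that bullet. Nothing else of [FW21, Thm. 4.41] is touched; (A) stays OPEN.

References: J.-P. Serre, Invent. Math. 15 (1972) §2.8 [Serre1972]; J. H. Silverman, *ATAEC*
(1994) V.4–V.5, Ex. 5.13(b) [SilvermanATAEC1994]; [FouquetWan2021] Thm. 4.41;
[Castella2018Erratum] Thm. 1.1 (i) and footnote 1; [ConradDiamondTaylor1999] Thm. 7.2.4 (the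
predicate `IsAbsIrreducibleOverSqrt`).
-/

noncomputable section

open scoped Classical NNReal Matrix

namespace Summit.BirchSwinnertonDyer.Rank1Residual.X11b.Transvection

open WeierstrassCurve NumberField IsDedekindDomain Field IsDedekindDomain.HeightOneSpectrum
  Literature.NumberTheory.EllipticCurves Literature.NumberTheory.GaloisRepresentations
  Literature.NumberTheory.EllipticCurves.Rank1Residual

variable (W : WeierstrassCurve ℚ) [W.IsElliptic] [W.IsGloballyMinimal] (p : ℕ) [Fact p.Prime]

/-! ### (ram) ⟹ a unipotent element of `Γ_ℚ`, non-trivial on `E[p]` -/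

/-- **(ram) ⟹ a unipotent Galois element non-trivial on `E[p]`.** For `W/ℚ` elliptic and globally
minimal and a prime `p`: if some prime `ℓ ≠ p` of multiplicative reduction has `p ∤ v_ℓ(Δ_min)`
(the cell's `Ram W p`), then some `σ ∈ Γ_ℚ` acts on `E[p] = E(ℚ̄)[p]` with `(σ − 1)² = 0` —
`σ (σ P − P) = σ P − P` — and moves some point of `E[p]`. (`σ` is the restriction to `ℚ̄` of an
inertia element at `ℓ`; Tate curve / Kodaira–Néron: the tree theorems
`exists_inertia_smul_ne_of_hasMultiplicativeReductionAtPrime` and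
`exists_unipotent_of_hasMultiplicativeReductionAt` at level `p¹`.) [folklore] -/
theorem exists_unipotent_geomTorsion_of_ram (hram : Ram W p) :
    ∃ σ : absoluteGaloisGroup ℚ,
      (∀ P : geomTorsion W (p : ℤ), σ • (σ • P - P) = σ • P - P) ∧
        ∃ Q : geomTorsion W (p : ℤ), σ • Q ≠ Q := by
  have hp : p.Prime := Fact.out
  obtain ⟨ℓ, hℓ, hℓp, hmult, hdiv⟩ := hram
  set v : HeightOneSpectrum (𝓞 ℚ) :=
    (Rat.HeightOneSpectrum.primesEquiv (R := 𝓞 ℚ)).symm ⟨ℓ, hℓ.out⟩ with hvdef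
  have hv : Rat.HeightOneSpectrum.primesEquiv v = ⟨ℓ, hℓ.out⟩ := Equiv.apply_symm_apply _ _
  have hvℓ : (Rat.HeightOneSpectrum.primesEquiv v : ℕ) = ℓ := congrArg Subtype.val hv
  obtain ⟨w, hw⟩ := v.exists_spectralValuation
  obtain ⟨𝔐, h𝔐⟩ := v.localPrimesAbove_nonempty
  -- the hypotheses at the place `v`
  have hmult_v : haveI := Fact.mk (Rat.HeightOneSpectrum.primesEquiv v).2;
      W.HasMultiplicativeReductionAtPrime (Rat.HeightOneSpectrum.primesEquiv v) := by
    have key : ∀ (q : ℕ) (hq : Fact q.Prime), q = ℓ →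
        @WeierstrassCurve.HasMultiplicativeReductionAtPrime W q hq := by
      rintro q hq rfl; exact hmult
    exact key _ _ hvℓ
  have hram_v : ¬ p ∣ padicValNat (Rat.HeightOneSpectrum.primesEquiv v)
      W.minimalDiscriminantInt.natAbs := by
    rw [hvℓ]; exact hdiv
  have hℓp' : (Rat.HeightOneSpectrum.primesEquiv v : ℕ) ≠ p := by rw [hvℓ]; exact hℓp
  have hloc := W.exists_inertia_smul_ne_of_hasMultiplicativeReductionAtPrime v hp hℓp' hmult_v
    hram_v hw h𝔐
  have hmultAt : W.HasMultiplicativeReductionAt v :=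
    (WeierstrassCurve.hasMultiplicativeReductionAtPrime_iff_hasMultiplicativeReductionAt_ringOfIntegers
      W v).mp hmult_v
  have hpv : (p : 𝓞 ℚ) ∉ v.asIdeal := by
    intro hmem
    have hv' := (natCast_mem_asIdeal_iff_eq_primesEquiv_symm v hp).mp hmem
    apply hℓp'
    rw [hv', Equiv.apply_symm_apply]
  have hU := W.exists_unipotent_of_hasMultiplicativeReductionAt hmultAt hp hpv (le_refl 1) hw h𝔐
    hloc
  rw [pow_one] at hU
  obtain ⟨σ, hσ, Q, -, hQ⟩ := hU
  exact ⟨σ, hσ, Q, hQ⟩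

/-! ### In a frame: the image of `ρ̄_{E,p}` contains a transvection -/

variable {p}

omit [W.IsElliptic] [W.IsGloballyMinimal] in
/-- Transport through a frame: if `e (σ • P) = ρ̄(σ) · e(P)` for all `P ∈ E[p]`, then
`(ρ̄(σ) − 1) · e(P) = e (σ • P − P)`. [folklore] -/
theorem sub_one_mulVec_frame {ρ : ModPGaloisRep ℚ (ZMod p) 2}
    (e : geomTorsion W (p : ℤ) ≃+ (Fin 2 → ZMod p))
    (he : ∀ (σ : absoluteGaloisGroup ℚ) (P : geomTorsion W (p : ℤ)),
      e (σ • P) = ((ρ σ : GL (Fin 2) (ZMod p)) : Matrix (Fin 2) (Fin 2) (ZMod p)) *ᵥ e P)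
    (σ : absoluteGaloisGroup ℚ) (P : geomTorsion W (p : ℤ)) :
    (((ρ σ : GL (Fin 2) (ZMod p)) : Matrix (Fin 2) (Fin 2) (ZMod p)) - 1) *ᵥ e P =
      e (σ • P - P) := by
  rw [Matrix.sub_mulVec, Matrix.one_mulVec, ← he σ P, map_sub]

variable (p)

/-- **The image of `ρ̄_{E,p}` contains a transvection under (ram).** For `W/ℚ` elliptic and
globally minimal, a prime `p` with `Ram W p`, and any framed model `ρ̄ : Γ_ℚ →ₜ* GL₂(𝔽_p)` of
`E[p]` (`W.IsTorsionGaloisRep p ρ̄`): some `σ ∈ Γ_ℚ` has `ρ̄(σ) ≠ 1` and `(ρ̄(σ) − 1)² = 0` — in a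
suitable basis `ρ̄(σ) = (1 1; 0 1)` (Serre 1972 §2.8; Silverman *ATAEC* Ex. 5.13(b)), here from
`exists_unipotent_geomTorsion_of_ram` transported through the frame. [folklore] -/
theorem exists_transvection_of_isTorsionGaloisRep_of_ram (hram : Ram W p)
    {ρ : ModPGaloisRep ℚ (ZMod p) 2} (hρ : W.IsTorsionGaloisRep p ρ) :
    ∃ σ : absoluteGaloisGroup ℚ,
      ((ρ σ : GL (Fin 2) (ZMod p)) : Matrix (Fin 2) (Fin 2) (ZMod p)) ≠ 1 ∧
        (((ρ σ : GL (Fin 2) (ZMod p)) : Matrix (Fin 2) (Fin 2) (ZMod p)) - 1) *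
          (((ρ σ : GL (Fin 2) (ZMod p)) : Matrix (Fin 2) (Fin 2) (ZMod p)) - 1) = 0 := by
  obtain ⟨σ, hσ, Q, hQ⟩ := exists_unipotent_geomTorsion_of_ram W p hram
  obtain ⟨e, he⟩ := hρ
  have hN : ∀ P : geomTorsion W (p : ℤ),
      (((ρ σ : GL (Fin 2) (ZMod p)) : Matrix (Fin 2) (Fin 2) (ZMod p)) - 1) *ᵥ e P =
        e (σ • P - P) :=
    sub_one_mulVec_frame W e he σ
  refine ⟨σ, ?_, ?_⟩
  · -- `ρ̄(σ) ≠ 1`: `σ` moves `Q`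
    intro h1
    apply hQ
    apply e.injective
    rw [he σ Q, h1, Matrix.one_mulVec]
  · -- `(ρ̄(σ) − 1)² = 0`: `(σ − 1)² = 0` on `E[p]`, read through `e`
    apply Matrix.toLin'.injective
    rw [map_zero]
    refine LinearMap.ext fun v => ?_
    rw [Matrix.toLin'_apply, LinearMap.zero_apply, ← Matrix.mulVec_mulVec,
      ← e.apply_symm_apply v, hN, hN, hσ, sub_self, map_zero]

/-! ### Absolute irreducibility over `Γ_ℚ` and over `Γ_K` for quadratic `K` -/

/-- **`Irr ∧ Ram` ⟹ `ρ̄_{E,p}` absolutely irreducible** (every prime `p`, also `p = 2`): an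
irreducible plane representation with a transvection in its image is absolutely irreducible
(`isAbsolutelyIrreducible_of_transvection`). For `p ≠ 2` this also follows from oddness
(`BCDT.isAbsolutelyIrreducible_of_hasIrreducibleModPGaloisRep`) without (ram). [folklore] -/
theorem isAbsolutelyIrreducible_of_irr_of_ram (hirr : Irr W p) (hram : Ram W p)
    {ρ : ModPGaloisRep ℚ (ZMod p) 2} (hρ : W.IsTorsionGaloisRep p ρ) :
    FramedRep.IsAbsolutelyIrreducible ρ := by
  obtain ⟨σ, hne, hsq⟩ := exists_transvection_of_isTorsionGaloisRep_of_ram W p hram hρ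
  exact isAbsolutelyIrreducible_of_transvection ρ
    (Literature.NumberTheory.Automorphic.BCDT.isIrreducible_of_hasIrreducibleModPGaloisRep hirr hρ)
    σ hne hsq

/-- **`Irr ∧ Ram`, `p ≠ 2` ⟹ `ρ̄_{E,p}|_{Γ_K}` absolutely irreducible for every quadratic
extension `K/ℚ`.** For `W/ℚ` elliptic and globally minimal, `p ≠ 2` a prime with `E[p]`
irreducible (`Irr W p`) and ramified at a multiplicative prime (`Ram W p`), any framed model `ρ̄` of
`E[p]`, and any field `K ⊇ ℚ` with `[K:ℚ] = 2`: the restriction `ρ̄|_{Γ_K}`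
(`FramedGaloisRep.restrictField K ρ̄`) is absolutely irreducible. This is the hypothesis
"`ρ̄_f|_{G_K}` absolutely irreducible" of [FW21, Thm. 4.41] bullet 1 and of [Cas20] (iv) for
`ρ̄ = E[p]` on the loci of routes R1/p2 (`ChainLocus ⊆ Irr ∧ Ram`, `p ≥ 5`), versus the erratum's
Thm. 1.1 (i) + footnote 1 ("irreducible"). Proof: `Γ_K ≤ Γ_ℚ` has index `2`
(`Automorphic.isOpen_range_absGaloisRestrict_and_index`), `E[p]` is irreducible in the frame
(`BCDT.isIrreducible_of_hasIrreducibleModPGaloisRep`), the image contains a transvection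
(`exists_transvection_of_isTorsionGaloisRep_of_ram`), and
`isAbsolutelyIrreducible_comp_of_index_two_of_transvection` (gen 5) applies since `2 ≠ 0` in
`𝔽_p`. [cite: FouquetWan2021, Thm. 4.41 (first bullet)] [cite: Castella2018Erratum, Thm. 1.1 (i) and footnote 1 (p. 4)] -/
theorem isAbsolutelyIrreducible_restrictField_of_irr_of_ram (hp2 : p ≠ 2) (hirr : Irr W p)
    (hram : Ram W p) {ρ : ModPGaloisRep ℚ (ZMod p) 2} (hρ : W.IsTorsionGaloisRep p ρ)
    (K : Type) [Field K] [Algebra ℚ K] [FiniteDimensional ℚ K] (hK : Module.finrank ℚ K = 2) :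
    FramedRep.IsAbsolutelyIrreducible (FramedGaloisRep.restrictField K ρ) := by
  have hp : p.Prime := Fact.out
  obtain ⟨σ, hne, hsq⟩ := exists_transvection_of_isTorsionGaloisRep_of_ram W p hram hρ
  have h2 : (2 : ZMod p) ≠ 0 := by
    change ((2 : ℕ) : ZMod p) ≠ 0
    rw [Ne, ZMod.natCast_eq_zero_iff]
    intro h
    exact hp2 ((Nat.prime_dvd_prime_iff_eq hp Nat.prime_two).mp h)
  have hindex : (absGaloisRestrict ℚ K).toMonoidHom.range.index = 2 := by
    have h := (Literature.NumberTheory.Automorphic.isOpen_range_absGaloisRestrict_and_index ℚ K).2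
    rw [hK] at h
    exact h
  exact isAbsolutelyIrreducible_comp_of_index_two_of_transvection ρ
    (Literature.NumberTheory.Automorphic.BCDT.isIrreducible_of_hasIrreducibleModPGaloisRep hirr hρ)
    h2 σ hne hsq (absGaloisRestrict ℚ K) hindex

open Polynomial in
/-- **`Irr ∧ Ram`, `p ≠ 2` ⟹ "`ρ̄_{E,p}|_{ℚ(√d)}` is absolutely irreducible"** for every
non-square `d : ℚ`, in the Conrad–Diamond–Taylor / BCDT spelling
`ModPGaloisRep.IsAbsIrreducibleOverSqrt d` (`BCDTModularity`: for every model `L` of the splitting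
field of `X² − d`, `ρ̄|_{Γ_L}` is absolutely irreducible; `[L:ℚ] = 2` by
`BCDT.finrank_eq_two_of_isSplittingField_X_pow_two_sub_C`). [cite: ConradDiamondTaylor1999, Thm. 7.2.4 (the hypothesis)] -/
theorem isAbsIrreducibleOverSqrt_of_irr_of_ram (hp2 : p ≠ 2) (hirr : Irr W p) (hram : Ram W p)
    {ρ : ModPGaloisRep ℚ (ZMod p) 2} (hρ : W.IsTorsionGaloisRep p ρ) {d : ℚ} (hd : ¬ IsSquare d) :
    ρ.IsAbsIrreducibleOverSqrt d := by
  intro L _ _ _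
  haveI : FiniteDimensional ℚ L := IsSplittingField.finiteDimensional L (X ^ 2 - C d)
  exact isAbsolutelyIrreducible_restrictField_of_irr_of_ram W p hp2 hirr hram hρ L
    (Literature.NumberTheory.Automorphic.BCDT.finrank_eq_two_of_isSplittingField_X_pow_two_sub_C hd L)

/-- **Existence form.** Under `Irr W p`, `Ram W p`, `p ≠ 2`: there is a framed model
`ρ̄ : Γ_ℚ →ₜ* GL₂(𝔽_p)` of `E[p]` (`WeierstrassCurve.exists_isTorsionGaloisRep`), and for every such
model and every quadratic `K/ℚ` the restriction `ρ̄|_{Γ_K}` is absolutely irreducible. [folklore] -/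
theorem exists_isTorsionGaloisRep_and_isAbsolutelyIrreducible_restrictField (hp2 : p ≠ 2)
    (hirr : Irr W p) (hram : Ram W p) :
    (∃ ρ : ModPGaloisRep ℚ (ZMod p) 2, W.IsTorsionGaloisRep p ρ) ∧
      ∀ (ρ : ModPGaloisRep ℚ (ZMod p) 2), W.IsTorsionGaloisRep p ρ →
        ∀ (K : Type) [Field K] [Algebra ℚ K] [FiniteDimensional ℚ K], Module.finrank ℚ K = 2 →
          FramedRep.IsAbsolutelyIrreducible (FramedGaloisRep.restrictField K ρ) := by
  have hp : p.Prime := Fact.out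
  haveI : NeZero ((p : ℕ) : ℚ) := ⟨by exact_mod_cast hp.ne_zero⟩
  exact ⟨W.exists_isTorsionGaloisRep p, fun ρ hρ K _ _ _ hK =>
    isAbsolutelyIrreducible_restrictField_of_irr_of_ram W p hp2 hirr hram hρ K hK⟩

end Summit.BirchSwinnertonDyer.Rank1Residual.X11b.Transvection

/-! ### On route R1's locus -/

namespace Summit.BirchSwinnertonDyer.Rank1Residual.X11b

open Literature.NumberTheory.GaloisRepresentations

/-- **On `ChainLocus`, `E[p]|_{Γ_K}` is absolutely irreducible for every quadratic `K/ℚ`.** Route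
R1's locus (`5 ≤ p`, `Mult`, `Irr`, the A′ + ram2 side conditions) contains `Irr W p` and gives
`Ram W p` (`ChainLocus.ram`, `RouteLoci.lean`), and `p ≥ 5 ≠ 2`; so for every framed model `ρ̄`
of `E[p]` and every `K ⊇ ℚ` with `[K:ℚ] = 2`, `ρ̄|_{Γ_K}` is absolutely irreducible — the
hypothesis "`ρ̄|_{G_K}` absolutely irreducible" of [FW21, Thm. 4.41] / [Cas20] (iv) at the
auxiliary imaginary quadratic field of the erratum, discharged from the class predicate alone.
[cite: FouquetWan2021, Thm. 4.41 (first bullet)] [cite: Castella2018Erratum, Thm. 1.1 (i) and footnote 1 (p. 4)] -/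
theorem ChainLocus.isAbsolutelyIrreducible_restrictField {W : WeierstrassCurve ℚ} [W.IsElliptic]
    [W.IsGloballyMinimal] {p : ℕ} [Fact p.Prime] (h : ChainLocus W p)
    {ρ : ModPGaloisRep ℚ (ZMod p) 2} (hρ : W.IsTorsionGaloisRep p ρ)
    (K : Type) [Field K] [Algebra ℚ K] [FiniteDimensional ℚ K] (hK : Module.finrank ℚ K = 2) :
    FramedRep.IsAbsolutelyIrreducible (FramedGaloisRep.restrictField K ρ) :=
  Transvection.isAbsolutelyIrreducible_restrictField_of_irr_of_ram W p (by have := h.1; omega)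
    h.2.2.1 h.ram hρ K hK

end Summit.BirchSwinnertonDyer.Rank1Residual.X11b

end
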